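import Literature.NumberTheory.Automorphic.UnitarySliceDatum                -- ★ p840996 (D1c): the field-level slice datum `exists_unitary_sliceDatum`
import Literature.NumberTheory.Automorphic.UnitarySliceDatumTransport       -- ★ p841032 A-p17 (g21) (m1): transport of a slice datum along `≃ₜ*`
import Literature.NumberTheory.Rogawski1990.LocalEndoscopicChartDatumCM     -- ★ p840612 A-p16: the one-place model facts at a non-split `v` (+ `cmDatum`, `localNonsplitEquiv`, …)
import HarnessLib

/-!
# The SLICE DATUM on `U(H)(L⁺_v)` at a SINGULAR SEMISIMPLE point, non-split `v`: Harish-Chandra's slice `(a, m) ↦ s(a)·m·s(a)⁻¹ : A × Z(ε₀) → U(H)(L⁺_v)`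
# with saturated, `Z(ε₀)`-separated compact-open boxes (N6nsGerm (S1)∕(S2), brick (D1)-CM)

Topic `NumberTheory/Rogawski1990`; namespace `Literature.NumberTheory.Rogawski1990`. KERNEL mathematics only: theorems, no definition, no named fact, no
instance, no notation, no `sorry`.  Cell `pub/hodgecm-mathlib` (LEAD F0P3a-plan (g9) WORD T8-38 (1) ∕ T8-60, road «N6nsGerm» of A-p12 (g18) ∕ F0P2-p02 (g8),
census `CENSUS-N6nsGerm-S1.A-p16g26.md` brick (D1)-CM = menu item (m4)).  The CM-level twin of ★ p840612 §2 at a SINGULAR semisimple point: for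
`ε₀ ∈ G′_v = U(H)(L⁺_v)` whose one-place image has an adapted frame `ε₀ P = P · reindex (a·1 ⊕ u·1)`, `a ≠ u` (e.g. `ε₀ = ι(a·1₂, u)`, the (S1) point of Rogawski's
Prop. 8.2.1, with the frames of ★ `SingularLocalConjugacy`), there are a topological space `A`, a continuous slice `s : A → G′_v` (`s a₀ = 1`), an
`OpenPartialHomeomorph e : A × Z_{G′_v}(ε₀) → G′_v` with `e(a, m) = s(a)·m·s(a)⁻¹` on its source and `(a₀, ε₀) ∈ e.source`, such that every neighbourhood of
`(a₀, ε₀)` contains a compact-open box `K × B₁ ⊆ e.source` which is SATURATED (`x m x⁻¹ ∈ e(K × B₁) ⇒ x ∈ s(K)·Z(ε₀)`) and `Z(ε₀)`-SEPARATED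
(`y m y⁻¹ = m′`, `m, m′ ∈ B₁` ⇒ `y ∈ Z(ε₀)`) — the chart half of the descent of orbital integrals to `Z(ε₀) ≅ U(1,1) × L_w¹` (Rogawski Prop. 8.2.1 (a)(c);
Langlands–Shelstad Thm. 2.3.A).  PIPELINE: ★∕⊙ `exists_unitary_sliceDatum` (A-p16 (D1c)) at `φ ε₀` in the one-place model `φ = localNonsplitEquiv`
(`L_w` proper, totally disconnected, characteristic zero) → ⊙ `exists_sliceDatum_transport_centralizer` (A-p17 (m1)) along `φ⁻¹`.

* §1 **`exists_sliceDatum_cmDatum_local_centralizer`** — frame hypothesis over the local FIELD `L_w` (on the one-place image of `ε₀`).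
* §2 **`exists_sliceDatum_cmDatum_local_centralizer_of_frame`** — frame hypothesis over `LocalRing L v` in ★ `SingularLocalConjugacy`'s shape
  (`ε₀ P₀ = P₀ · finSum N₁ N₂ (a·1) (u·1)`, `a ≠ u`), mapped to §1 along the one-place ring isomorphism.

HONEST SCOPE.  Point-set topology of the local unitary groups only.  HC_CM is proved only modulo the printed citations until rung 0 closes; this file discharges no
printed statement (it serves `stub_N6nsS1`∕`stub_N6nsS2` of the «N6nsGerm» line as the chart input of the descent (D2)).

## References
* [Rogawski1990] J. D. Rogawski, *Automorphic Representations of Unitary Groups in Three Variables*, Ann. of Math. Stud. 123 (1990), §3.8 Prop. 3.8.1 p. 30 (frames at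
  singular semisimple classes), §8.2 Prop. 8.2.1 pp. 112–116 (descent at `γ₀`).
* [HarishChandra1970] Harish-Chandra (notes by G. van Dijk), *Harmonic Analysis on Reductive p-adic Groups*, LNM 162 (1970), Part II §5.
* [PlatonovRapinchuk1994] V. Platonov, A. Rapinchuk, *Algebraic Groups and Number Theory* (1994), §5.1 (the one-place model `U(H)(F_v) ≅ U(σ_w, H_w)(E_w)`).
-/

set_option autoImplicit false

noncomputable section

open Set Filter Topology Polynomial NumberField IsDedekindDomain
open Literature.NumberTheory.Automorphic Literature.NumberTheory.Automorphic.UnitaryGroup Literature.Analysis.Calculus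
open scoped Matrix MatrixGroups Pointwise

namespace Literature.NumberTheory.Rogawski1990

variable (L : Type) [Field L] [NumberField L] [IsCMField L] {v : HeightOneSpectrum (𝓞 ↥(maximalRealSubfield L))}

/-! ## §1 The slice datum on `U(H)(L⁺_v)` at `ε₀` with a frame over `L_w` -/

section FieldFrame

variable {N : ℕ} (H : Matrix (Fin N) (Fin N) L)

/-- **(D1)-CM: THE SLICE DATUM ON `G′_v = U(H)(L⁺_v)` AT A SINGULAR SEMISIMPLE `ε₀`**, non-split `v` (`w ∣ v`, `w̄ = w`), frame over `L_w` on the one-place image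
`φ ε₀` (`φ = localNonsplitEquiv`): `φ ε₀ · P = P · reindex e (a·1 ⊕ u·1)`, `a ≠ u`.  Conclusion: `A`, continuous `s : A → G′_v` with `s a₀ = 1`, an
`OpenPartialHomeomorph e : A × ↥Z(ε₀) → G′_v` with `e(a, m) = s(a)·m·s(a)⁻¹` on its source, `(a₀, t₀) ∈ e.source`, `↑t₀ = ε₀`, and for every neighbourhood `O` of
`(a₀, t₀)` a compact-open box `K × B₁ ⊆ O ∩ e.source` (`a₀ ∈ K`, `t₀ ∈ B₁`), SATURATED and `Z(ε₀)`-SEPARATED.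
[cite: Rogawski1990, §8.2 Prop. 8.2.1 pp. 112–116; §3.8 Prop. 3.8.1 p. 30] [cite: HarishChandra1970, Part II §5] [cite: PlatonovRapinchuk1994, §5.1] -/
theorem exists_sliceDatum_cmDatum_local_centralizer (hHd : IsUnit H.det) (w : PlacesOver L v) (hw : IsCMField.complexConj L • w.1 = w.1)
    (ε₀ : (cmDatum L N H).Local v) {m o : Type} [Fintype m] [DecidableEq m] [Fintype o] [DecidableEq o]
    {a u : w.1.adicCompletion L} (hau : a ≠ u) (P : GL (Fin N) (w.1.adicCompletion L)) (eι : m ⊕ o ≃ Fin N)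
    (hP : (((localNonsplitEquiv (IsCMField.complexConj L) H (IsCMField.complexConj_ne_one L) w hw ε₀ :
          unitaryGroupOfForm (galAdicCompletionMap (L := L) (IsCMField.complexConj L) hw) (placeForm H w.1)) :
          GL (Fin N) (w.1.adicCompletion L)) : Matrix (Fin N) (Fin N) (w.1.adicCompletion L)) * P.val =
        P.val * Matrix.reindex eι eι (Matrix.fromBlocks (a • (1 : Matrix m m (w.1.adicCompletion L))) 0 0 (u • (1 : Matrix o o (w.1.adicCompletion L))))) :
    ∃ (A : Type) (_ : TopologicalSpace A) (s : A → (cmDatum L N H).Local v)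
      (e : OpenPartialHomeomorph (A × ↥(Subgroup.centralizer ({ε₀} : Set ((cmDatum L N H).Local v)))) ((cmDatum L N H).Local v))
      (a₀ : A) (t₀ : ↥(Subgroup.centralizer ({ε₀} : Set ((cmDatum L N H).Local v)))),
      Continuous s ∧ s a₀ = 1 ∧ (t₀ : (cmDatum L N H).Local v) = ε₀ ∧ (a₀, t₀) ∈ e.source ∧
      (∀ p ∈ e.source, e p = s p.1 * (p.2 : (cmDatum L N H).Local v) * (s p.1)⁻¹) ∧
      ∀ O ∈ 𝓝 (a₀, t₀), ∃ (K : Set A) (B₁ : Set ↥(Subgroup.centralizer ({ε₀} : Set ((cmDatum L N H).Local v)))),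
        IsCompact K ∧ IsOpen K ∧ a₀ ∈ K ∧ IsCompact B₁ ∧ IsOpen B₁ ∧ t₀ ∈ B₁ ∧ K ×ˢ B₁ ⊆ O ∧ K ×ˢ B₁ ⊆ e.source ∧
        (∀ t ∈ B₁, ∀ x : (cmDatum L N H).Local v, x * (t : (cmDatum L N H).Local v) * x⁻¹ ∈ e '' (K ×ˢ B₁) →
          x ∈ s '' K * (Subgroup.centralizer ({ε₀} : Set ((cmDatum L N H).Local v)) : Set ((cmDatum L N H).Local v))) ∧
        (∀ t ∈ B₁, ∀ t' ∈ B₁, ∀ y : (cmDatum L N H).Local v,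
          y * (t : (cmDatum L N H).Local v) * y⁻¹ = (t' : (cmDatum L N H).Local v) →
            y ∈ Subgroup.centralizer ({ε₀} : Set ((cmDatum L N H).Local v))) := by
  classical
  -- `L_w` as a complete proper totally disconnected non-trivially normed field of characteristic zero
  letI : NontriviallyNormedField (w.1.adicCompletion L) := Valued.toNontriviallyNormedField (w.1.adicCompletion L) (WithZero (Multiplicative ℤ))
  haveI : ProperSpace (w.1.adicCompletion L) := properSpace_adicCompletion L w.1
  haveI : CharZero (w.1.adicCompletion L) := charZero_of_injective_algebraMap (algebraMap L _).injective
  haveI : TotallyDisconnectedSpace (w.1.adicCompletion L) := Valued.totallyDisconnectedSpace'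
  set φ := localNonsplitEquiv (IsCMField.complexConj L) H (IsCMField.complexConj_ne_one L) w hw with hφ
  have hJ : IsUnit (placeForm H w.1).det := (Matrix.isUnit_iff_isUnit_det _).1 (isUnit_placeForm_of_isUnit_det hHd w.1)
  -- the field-level slice datum at `φ ε₀`
  obtain ⟨s₁, eT, a₀, t₁, -, hs₁, -, hs₁0, ht₁, hT₀, heT, hboxT⟩ :=
    exists_unitary_sliceDatum (galAdicCompletionMap (L := L) (IsCMField.complexConj L) hw)
      (continuous_galAdicCompletionMap L (IsCMField.complexConj L) hw) hJ (φ ε₀) hau P eι hP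
  -- transport along `φ⁻¹`
  obtain ⟨e', t₀, ht₀, hsrc, he', hbox'⟩ :=
    exists_sliceDatum_transport_centralizer φ.symm s₁ (φ ε₀) ε₀ (φ.symm_apply_apply ε₀) eT heT hT₀ hboxT
  refine ⟨_, inferInstance, fun a => φ.symm (s₁ a), e', a₀, t₀, φ.symm.continuous.comp hs₁, ?_, ?_, hsrc, he', hbox'⟩
  · show φ.symm (s₁ a₀) = 1
    rw [hs₁0, map_one]
  · rw [ht₀, ht₁, φ.symm_apply_apply]

end FieldFrame

/-! ## §2 The same with a frame over `LocalRing L v` (★ `SingularLocalConjugacy`'s shape) -/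

section LocalRingFrame

variable {N₁ N₂ : ℕ} (H : Matrix (Fin (N₁ + N₂)) (Fin (N₁ + N₂)) L)

/-- **(D1)-CM with the frame over `LocalRing L v`**: `ε₀ P₀ = P₀ · (a·1 ⊕ᶠ u·1)` with `a ≠ u` in `L ⊗ L⁺_v` (the adapted frames of ★ `SingularLocalConjugacy`,
`finSum N₁ N₂`), mapped along the one-place ring isomorphism `L ⊗ L⁺_v ≃ L_w` to §1. [cite: Rogawski1990, §3.8 Prop. 3.8.1 p. 30; §8.2 Prop. 8.2.1 p. 112]
[cite: PlatonovRapinchuk1994, §5.1] -/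
theorem exists_sliceDatum_cmDatum_local_centralizer_of_frame (hHd : IsUnit H.det) (w : PlacesOver L v) (hw : IsCMField.complexConj L • w.1 = w.1)
    (ε₀ : (cmDatum L (N₁ + N₂) H).Local v) (P₀ : GL (Fin (N₁ + N₂)) (LocalRing L v)) {a u : LocalRing L v} (hau : a ≠ u)
    (hP₀ : (ε₀.val.val : Matrix (Fin (N₁ + N₂)) (Fin (N₁ + N₂)) (LocalRing L v)) * P₀.val =
      P₀.val * finSum N₁ N₂ (a • (1 : Matrix (Fin N₁) (Fin N₁) (LocalRing L v))) (u • (1 : Matrix (Fin N₂) (Fin N₂) (LocalRing L v)))) :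
    ∃ (A : Type) (_ : TopologicalSpace A) (s : A → (cmDatum L (N₁ + N₂) H).Local v)
      (e : OpenPartialHomeomorph (A × ↥(Subgroup.centralizer ({ε₀} : Set ((cmDatum L (N₁ + N₂) H).Local v)))) ((cmDatum L (N₁ + N₂) H).Local v))
      (a₀ : A) (t₀ : ↥(Subgroup.centralizer ({ε₀} : Set ((cmDatum L (N₁ + N₂) H).Local v)))),
      Continuous s ∧ s a₀ = 1 ∧ (t₀ : (cmDatum L (N₁ + N₂) H).Local v) = ε₀ ∧ (a₀, t₀) ∈ e.source ∧
      (∀ p ∈ e.source, e p = s p.1 * (p.2 : (cmDatum L (N₁ + N₂) H).Local v) * (s p.1)⁻¹) ∧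
      ∀ O ∈ 𝓝 (a₀, t₀), ∃ (K : Set A) (B₁ : Set ↥(Subgroup.centralizer ({ε₀} : Set ((cmDatum L (N₁ + N₂) H).Local v)))),
        IsCompact K ∧ IsOpen K ∧ a₀ ∈ K ∧ IsCompact B₁ ∧ IsOpen B₁ ∧ t₀ ∈ B₁ ∧ K ×ˢ B₁ ⊆ O ∧ K ×ˢ B₁ ⊆ e.source ∧
        (∀ t ∈ B₁, ∀ x : (cmDatum L (N₁ + N₂) H).Local v, x * (t : (cmDatum L (N₁ + N₂) H).Local v) * x⁻¹ ∈ e '' (K ×ˢ B₁) →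
          x ∈ s '' K * (Subgroup.centralizer ({ε₀} : Set ((cmDatum L (N₁ + N₂) H).Local v)) : Set ((cmDatum L (N₁ + N₂) H).Local v))) ∧
        (∀ t ∈ B₁, ∀ t' ∈ B₁, ∀ y : (cmDatum L (N₁ + N₂) H).Local v,
          y * (t : (cmDatum L (N₁ + N₂) H).Local v) * y⁻¹ = (t' : (cmDatum L (N₁ + N₂) H).Local v) →
            y ∈ Subgroup.centralizer ({ε₀} : Set ((cmDatum L (N₁ + N₂) H).Local v))) := by
  classical
  letI : Unique (PlacesOver L v) :=
    @uniqueOfSubsingleton _ (PlacesOver.subsingleton_of_smul_eq (IsCMField.complexConj L) (IsCMField.complexConj_ne_one L) w hw) w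
  -- the one-place ring isomorphism and the matrix of `φ ε₀`
  set ψ : LocalRing L v →+* w.1.adicCompletion L := Pi.evalRingHom (fun w' : PlacesOver L v => w'.1.adicCompletion L) w with hψdef
  have hψinj : Function.Injective ψ := by
    have hψ : ψ = (RingEquiv.piUnique fun w' : PlacesOver L v => w'.1.adicCompletion L).toRingHom := RingHom.ext fun _ => rfl
    rw [hψ]
    exact (RingEquiv.piUnique fun w' : PlacesOver L v => w'.1.adicCompletion L).injective
  have hmat : (((localNonsplitEquiv (IsCMField.complexConj L) H (IsCMField.complexConj_ne_one L) w hw ε₀ :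
          unitaryGroupOfForm (galAdicCompletionMap (L := L) (IsCMField.complexConj L) hw) (placeForm H w.1)) :
          GL (Fin (N₁ + N₂)) (w.1.adicCompletion L)) : Matrix (Fin (N₁ + N₂)) (Fin (N₁ + N₂)) (w.1.adicCompletion L)) =
      (ε₀.val.val : Matrix (Fin (N₁ + N₂)) (Fin (N₁ + N₂)) (LocalRing L v)).map ψ := rfl
  -- the mapped frame
  have hsmul : ∀ (k : ℕ) (c : LocalRing L v), (c • (1 : Matrix (Fin k) (Fin k) (LocalRing L v))).map ψ = ψ c • (1 : Matrix (Fin k) (Fin k) (w.1.adicCompletion L)) :=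
    fun k c => by rw [Matrix.smul_one_eq_diagonal, Matrix.diagonal_map (map_zero ψ), Matrix.smul_one_eq_diagonal]
  have hfin : (finSum N₁ N₂ (a • (1 : Matrix (Fin N₁) (Fin N₁) (LocalRing L v))) (u • (1 : Matrix (Fin N₂) (Fin N₂) (LocalRing L v)))).map ψ =
      Matrix.reindex finSumFinEquiv finSumFinEquiv
        (Matrix.fromBlocks (ψ a • (1 : Matrix (Fin N₁) (Fin N₁) (w.1.adicCompletion L))) 0 0 (ψ u • (1 : Matrix (Fin N₂) (Fin N₂) (w.1.adicCompletion L)))) := by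
    rw [finSum, Matrix.reindex_apply, Matrix.reindex_apply, ← Matrix.submatrix_map, Matrix.fromBlocks_map, hsmul, hsmul, Matrix.map_zero ψ (map_zero ψ), Matrix.map_zero ψ (map_zero ψ)]
  have hP : (((localNonsplitEquiv (IsCMField.complexConj L) H (IsCMField.complexConj_ne_one L) w hw ε₀ :
          unitaryGroupOfForm (galAdicCompletionMap (L := L) (IsCMField.complexConj L) hw) (placeForm H w.1)) :
          GL (Fin (N₁ + N₂)) (w.1.adicCompletion L)) : Matrix (Fin (N₁ + N₂)) (Fin (N₁ + N₂)) (w.1.adicCompletion L)) *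
        (Matrix.GeneralLinearGroup.map ψ P₀).val =
      (Matrix.GeneralLinearGroup.map ψ P₀).val * Matrix.reindex finSumFinEquiv finSumFinEquiv
        (Matrix.fromBlocks (ψ a • (1 : Matrix (Fin N₁) (Fin N₁) (w.1.adicCompletion L))) 0 0 (ψ u • (1 : Matrix (Fin N₂) (Fin N₂) (w.1.adicCompletion L)))) := by
    have h := congrArg (fun M : Matrix (Fin (N₁ + N₂)) (Fin (N₁ + N₂)) (LocalRing L v) => M.map ψ) hP₀
    simp only [Matrix.map_mul] at h
    rw [hmat, ← hfin]
    exact h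
  exact exists_sliceDatum_cmDatum_local_centralizer L H hHd w hw ε₀ (hψinj.ne hau) (Matrix.GeneralLinearGroup.map ψ P₀) finSumFinEquiv hP

end LocalRingFrame

end Literature.NumberTheory.Rogawski1990
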